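/-
Copyright (c) 2026 the pub-hodgecm2 formalisation cell (harness21).  New file, outside the frozen port manifest.
Origin: wall-breaker seat `prover-pub-hodgecm2-d2bridge-wb-8-g0-0` (WB-8, sub-socket S-b «equivariance under ι₁ ↦ ῑ₁», structural ∕
definitional route), 2026-08-23.  RE-KEY INPUT (coordinator verdict MIS-KEY ∕ (c-S), flip site «`muLiu`'s sign at w₁»): the recipe of record
under the conjugate pin.  Theorems only, explicit binders, no `sorry`, no new definition.  HC_CM is NOT proved; «Δ2 BRIDGE CLOSED» is NOT claimed.
-/
import Summits.HodgeConjecture.HodgeCM.Model.LiuIndexMuLiu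
import HarnessLib

set_option autoImplicit false

/-!
# S-b fragment: Liu's weight-one table `muLiu` under the conjugate pin `ῑ₁ := conj ∘ ι₁`

`ῑ₁` and `ι₁` define the same place (`w̄₁ = w₁`), and a CM type contains exactly one of them; so the recipe of record flips sign:
`muLiu ῑ₁ ρ q = - muLiu ι₁ ρ q` for every section `ρ` and class `q` (at `w₁`: `∓1 ↦ ±1`; elsewhere `0`).  This is the kernel form of the
flip site «`muLiu`'s sign at `w₁`» of the orientation re-key (GAP-READ-1), for `REKEY-FLIPSITES.md`.
-/

noncomputable section

namespace Summit.HodgeConjecture.CorCM.D2Bridge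

open NumberField NumberField.InfinitePlace NumberField.ComplexEmbedding
open HodgeCM HodgeCM.Model HodgeCM.Model.LiuIndex

variable {L : CMField}

/-- `conj ∘ ι₁` is Mathlib's conjugate embedding `ComplexEmbedding.conjugate ι₁` (definitionally). [folklore] -/
theorem starRingEnd_comp_eq_conjugate (ι₁ : (L : Type) →+* ℂ) : (starRingEnd ℂ).comp ι₁ = conjugate ι₁ :=
  RingHom.ext fun _ => rfl

/-- The real place under the conjugate pin is the real place under the pin (`mk ῑ₁ = mk ι₁`). [folklore] -/
theorem cmPlace_starRingEnd_comp (ι₁ : (L : Type) →+* ℂ) :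
    HypCensus.cmPlace (L : Type) ((starRingEnd ℂ).comp ι₁) = HypCensus.cmPlace (L : Type) ι₁ := by
  apply Subtype.ext
  change ((mk ((starRingEnd ℂ).comp ι₁)).comap _) = (mk ι₁).comap _
  rw [starRingEnd_comp_eq_conjugate, mk_conjugate_eq]

/-- The indicator `𝟙_{w₁}` is the same for `ι₁` and `ῑ₁`. [folklore] -/
theorem placeIndicator_starRingEnd_comp (ι₁ : (L : Type) →+* ℂ) :
    placeIndicator (L := L) ((starRingEnd ℂ).comp ι₁) = placeIndicator (L := L) ι₁ := by
  unfold placeIndicator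
  rw [cmPlace_starRingEnd_comp]

/-- **`muLiu` flips sign under the conjugate pin**: `muLiu ῑ₁ ρ q = - muLiu ι₁ ρ q` (the CM type `Φ^δ(q)` contains exactly one of `ι₁`, `ῑ₁`;
the place indicator is unchanged).  The flip site «`muLiu`'s sign at `w₁`» of the orientation re-key, in the kernel. [folklore] -/
theorem muLiu_starRingEnd_comp (ι₁ : (L : Type) →+* ℂ) (ρ : GramClass L → RealScalar L) (q : GramClass L) :
    muLiu ((starRingEnd ℂ).comp ι₁) ρ q = -muLiu ι₁ ρ q := by
  by_cases h : ι₁ ∈ (SignRecipe.lineType (GramClass.scalar ρ q) (GramClass.conj_scalar ρ q) (GramClass.scalar_ne ρ q)).1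
  · have h' : (starRingEnd ℂ).comp ι₁ ∉
        (SignRecipe.lineType (GramClass.scalar ρ q) (GramClass.conj_scalar ρ q) (GramClass.scalar_ne ρ q)).1 := by
      rw [starRingEnd_comp_eq_conjugate, HodgeCM.CMTypeOps.conjugate_mem_iff_notMem, not_not]
      exact h
    rw [muLiu_of_mem h, muLiu_of_not_mem h', placeIndicator_starRingEnd_comp, neg_neg]
  · have h' : (starRingEnd ℂ).comp ι₁ ∈
        (SignRecipe.lineType (GramClass.scalar ρ q) (GramClass.conj_scalar ρ q) (GramClass.scalar_ne ρ q)).1 := by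
      rw [starRingEnd_comp_eq_conjugate, HodgeCM.CMTypeOps.conjugate_mem_iff_notMem]
      exact h
    rw [muLiu_of_not_mem h, muLiu_of_mem h', placeIndicator_starRingEnd_comp]

/-- Pointwise form: `muLiu ῑ₁ ρ q w = - muLiu ι₁ ρ q w`. [folklore] -/
theorem muLiu_starRingEnd_comp_apply (ι₁ : (L : Type) →+* ℂ) (ρ : GramClass L → RealScalar L) (q : GramClass L)
    (w : InfinitePlace (L : Type)) :
    muLiu ((starRingEnd ℂ).comp ι₁) ρ q w = -muLiu ι₁ ρ q w := by
  rw [muLiu_starRingEnd_comp, Pi.neg_apply]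

/-- As functions of the class: `muLiu ῑ₁ ρ = -muLiu ι₁ ρ`. [folklore] -/
theorem muLiu_starRingEnd_comp_eq_neg (ι₁ : (L : Type) →+* ℂ) (ρ : GramClass L → RealScalar L) :
    muLiu ((starRingEnd ℂ).comp ι₁) ρ = -muLiu ι₁ ρ :=
  funext fun q => muLiu_starRingEnd_comp ι₁ ρ q

/-- **The `PhiMu` slot flips under the conjugate pin**: `PhiMuLine ῑ₁ p ↔ ¬ PhiMuLine ι₁ p` (`Φ^δ(p)` contains exactly one of `ι₁`, `ῑ₁`) —
the flip site «`PhiMuLine ι₁`» (`liuDictionaryOfWeilFamily` :254) of the orientation re-key, in the kernel. [folklore] -/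
theorem phiMuLine_starRingEnd_comp_iff (ι₁ : (L : Type) →+* ℂ)
    {JV : Matrix (Fin 3) (Fin 3) (L : Type)} {TV : Matrix (Fin 3) (Fin 3) ↥(maximalRealSubfield (L : Type))}
    {δ : (L : Type)} {hcδ : IsCMField.complexConj (L : Type) δ = -δ} {hδ : δ ≠ 0} {d : ↥(maximalRealSubfield (L : Type))}
    {hd : δ * δ = algebraMap _ (L : Type) d} {hV : TV.IsSymm} {hVd : IsUnit TV.det}
    {hJV : JV = TV.map (algebraMap _ (L : Type))}
    (p : SplitLine JV TV hcδ hδ hd hV hVd hJV) :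
    SplitLine.PhiMuLine ((starRingEnd ℂ).comp ι₁) p ↔ ¬ SplitLine.PhiMuLine ι₁ p := by
  change (starRingEnd ℂ).comp ι₁ ∈ (p.lineType).1 ↔ ¬ ι₁ ∈ (p.lineType).1
  rw [starRingEnd_comp_eq_conjugate]
  exact HodgeCM.CMTypeOps.conjugate_mem_iff_notMem _ _

end Summit.HodgeConjecture.CorCM.D2Bridge

end
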